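import Mathlib.Analysis.Calculus.FDeriv.Analytic
import Mathlib.Analysis.Calculus.ContDiff.Operations
import Mathlib.Analysis.Analytic.Constructions
import Mathlib.Analysis.Calculus.Deriv.Mul
import Mathlib.Analysis.Calculus.Deriv.Comp
import Mathlib.Order.Filter.AtTopBot.Field
import HarnessLib

/-!
# Buckmaster–Cao-Labora–Gómez-Serrano at `γ = 5/3`: the scaling symmetry of the profile equation

Topic `Literature/Analysis/FluidPDE`; namespace
`Literature.Analysis.FluidPDE.BuckmasterCaolaboraGomezserrano2025`. Companion of
`CompressibleEulerImplosion.lean` (named fact `BuckmasterCaolaboraGomezserrano2025_thm11_monatomic`,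
THEOREM 1.1 of T. Buckmaster, G. Cao-Labora, J. Gómez-Serrano, *Smooth imploding solutions for 3D
compressible fluids*, Forum Math. Pi 13 (2025) e6, arXiv:2208.09445, at `γ = 5/3`, `α = 1/3`).
Brick D2 of the discharge plan. The single profile equation (1.10),

  `(r−1)𝒲(ζ) + (ζ + ½(𝒲(ζ) − 𝒲(−ζ) + ⅓(𝒲(ζ) + 𝒲(−ζ)))) 𝒲′(ζ) + (1/(6ζ))(𝒲(ζ)² − 𝒲(−ζ)²) = 0`,

is invariant under the scaling `𝒲 ↦ 𝒲_c`, `𝒲_c(ζ) = c⁻¹ 𝒲(cζ)` (`c ≠ 0`); on the Taylor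
coefficients at `ζ = 0` this is `wᵢ ↦ cⁱ⁻¹ wᵢ`, in particular `w₀ = A ↦ A/c`. This is the freedom
"For any `A > 0`" of Proposition 2.5, used in §2.3 to normalise the solution issued from `P₀` so
that it reaches `P_s` at `ζ = 1` ("From now on, we will always choose `A` such that the solution
reaches `P_s` at `ξ = 0` (that is, `ζ = 1`)"); in the logarithmic variable `ξ = log ζ` it is the
translation invariance of the autonomous system (1.8) ("Since the system (1.8) is autonomous, we
are free to fix the location `ξ` for which the solutions crosses `P_s`", §1.3). This file PROVES
(theorems only) that every hypothesis of the glue theorem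
`BuckmasterCaolaboraGomezserrano2025.thm11_monatomic_of_profile` is transported along the scaling
for `c > 0` (`profile_eq_scale`, `analyticAt_scale`, `contDiffAt_scale`, `pos_scale`,
`tendsto_div_scale`, `tendsto_neg_div_scale`).
[cite: BuckmasterCaolaboraGomezserrano2025, §1.3, Prop. 2.5, §2.3]
-/

noncomputable section

open Set Filter Topology
open scoped ContDiff

namespace Literature.Analysis.FluidPDE

namespace BuckmasterCaolaboraGomezserrano2025

/-- Derivative of the rescaled profile `ζ ↦ c⁻¹ 𝒲(cζ)`: `(𝒲_c)′(ζ) = 𝒲′(cζ)`. [folklore] -/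
theorem hasDerivAt_scale {𝒲 : ℝ → ℝ} {c ζ : ℝ} (hc : c ≠ 0)
    (hd : DifferentiableAt ℝ 𝒲 (c * ζ)) :
    HasDerivAt (fun x => c⁻¹ * 𝒲 (c * x)) (deriv 𝒲 (c * ζ)) ζ := by
  have h1 : HasDerivAt (fun x => c * x) c ζ := by
    simpa using (hasDerivAt_id ζ).const_mul c
  have h2 : HasDerivAt (fun x => 𝒲 (c * x)) (deriv 𝒲 (c * ζ) * c) ζ :=
    hd.hasDerivAt.comp ζ h1
  have h3 := h2.const_mul c⁻¹
  refine h3.congr_deriv ?_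
  field_simp

/-- [folklore] -/
theorem deriv_scale {𝒲 : ℝ → ℝ} {c ζ : ℝ} (hc : c ≠ 0) (hd : DifferentiableAt ℝ 𝒲 (c * ζ)) :
    deriv (fun x => c⁻¹ * 𝒲 (c * x)) ζ = deriv 𝒲 (c * ζ) :=
  (hasDerivAt_scale hc hd).deriv

/-- **Scaling invariance of (1.10).** If `𝒲` is differentiable at `cζ` and satisfies the single
profile equation (1.10) (`α = 1/3`) at the point `cζ` (`c, ζ ≠ 0`), then `𝒲_c(x) = c⁻¹𝒲(cx)`
satisfies it at `ζ`. [cite: BuckmasterCaolaboraGomezserrano2025, §1.3, §2.3] -/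
theorem profile_eq_scale {r : ℝ} {𝒲 : ℝ → ℝ} {c ζ : ℝ} (hc : c ≠ 0) (hζ : ζ ≠ 0)
    (hd : DifferentiableAt ℝ 𝒲 (c * ζ))
    (h : (r - 1) * 𝒲 (c * ζ)
      + (c * ζ + 1 / 2 * (𝒲 (c * ζ) - 𝒲 (-(c * ζ)) + 1 / 3 * (𝒲 (c * ζ) + 𝒲 (-(c * ζ)))))
          * deriv 𝒲 (c * ζ)
      + 1 / 3 / (2 * (c * ζ)) * (𝒲 (c * ζ) ^ 2 - 𝒲 (-(c * ζ)) ^ 2) = 0) :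
    (r - 1) * (fun x => c⁻¹ * 𝒲 (c * x)) ζ
      + (ζ + 1 / 2 * ((fun x => c⁻¹ * 𝒲 (c * x)) ζ - (fun x => c⁻¹ * 𝒲 (c * x)) (-ζ)
          + 1 / 3 * ((fun x => c⁻¹ * 𝒲 (c * x)) ζ + (fun x => c⁻¹ * 𝒲 (c * x)) (-ζ))))
          * deriv (fun x => c⁻¹ * 𝒲 (c * x)) ζ
      + 1 / 3 / (2 * ζ) * ((fun x => c⁻¹ * 𝒲 (c * x)) ζ ^ 2
          - (fun x => c⁻¹ * 𝒲 (c * x)) (-ζ) ^ 2) = 0 := by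
  simp only [mul_neg]
  rw [deriv_scale hc hd]
  set a := 𝒲 (c * ζ)
  set b := 𝒲 (-(c * ζ))
  set d := deriv 𝒲 (c * ζ)
  have key : (r - 1) * (c⁻¹ * a)
      + (ζ + 1 / 2 * (c⁻¹ * a - c⁻¹ * b + 1 / 3 * (c⁻¹ * a + c⁻¹ * b))) * d
      + 1 / 3 / (2 * ζ) * ((c⁻¹ * a) ^ 2 - (c⁻¹ * b) ^ 2)
      = c⁻¹ * ((r - 1) * a + (c * ζ + 1 / 2 * (a - b + 1 / 3 * (a + b))) * d
          + 1 / 3 / (2 * (c * ζ)) * (a ^ 2 - b ^ 2)) := by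
    field_simp
  rw [key, h, mul_zero]

/-- **Scaling, global form.** If `𝒲` is differentiable away from `0` and solves (1.10) at every
`ζ ≠ 0`, so does `𝒲_c` (`c ≠ 0`). [cite: BuckmasterCaolaboraGomezserrano2025, §1.3, §2.3] -/
theorem profile_ode_scale {r : ℝ} {𝒲 : ℝ → ℝ} {c : ℝ} (hc : c ≠ 0)
    (hd : ∀ ζ : ℝ, ζ ≠ 0 → DifferentiableAt ℝ 𝒲 ζ)
    (h : ∀ ζ : ℝ, ζ ≠ 0 → (r - 1) * 𝒲 ζ
      + (ζ + 1 / 2 * (𝒲 ζ - 𝒲 (-ζ) + 1 / 3 * (𝒲 ζ + 𝒲 (-ζ)))) * deriv 𝒲 ζ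
      + 1 / 3 / (2 * ζ) * (𝒲 ζ ^ 2 - 𝒲 (-ζ) ^ 2) = 0) :
    ∀ ζ : ℝ, ζ ≠ 0 → (r - 1) * (fun x => c⁻¹ * 𝒲 (c * x)) ζ
      + (ζ + 1 / 2 * ((fun x => c⁻¹ * 𝒲 (c * x)) ζ - (fun x => c⁻¹ * 𝒲 (c * x)) (-ζ)
          + 1 / 3 * ((fun x => c⁻¹ * 𝒲 (c * x)) ζ + (fun x => c⁻¹ * 𝒲 (c * x)) (-ζ))))
          * deriv (fun x => c⁻¹ * 𝒲 (c * x)) ζ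
      + 1 / 3 / (2 * ζ) * ((fun x => c⁻¹ * 𝒲 (c * x)) ζ ^ 2
          - (fun x => c⁻¹ * 𝒲 (c * x)) (-ζ) ^ 2) = 0 :=
  fun _ hζ => profile_eq_scale hc hζ (hd _ (mul_ne_zero hc hζ)) (h _ (mul_ne_zero hc hζ))

/-- The value at the origin scales as `w₀ = A ↦ A/c`. [cite: BuckmasterCaolaboraGomezserrano2025, Prop. 2.5] -/
theorem scale_zero (𝒲 : ℝ → ℝ) (c : ℝ) : (fun x => c⁻¹ * 𝒲 (c * x)) 0 = c⁻¹ * 𝒲 0 := by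
  simp

/-- Analyticity at the origin is preserved by the scaling. [folklore] -/
theorem analyticAt_scale {𝒲 : ℝ → ℝ} {c : ℝ} (h : AnalyticAt ℝ 𝒲 0) :
    AnalyticAt ℝ (fun x => c⁻¹ * 𝒲 (c * x)) 0 := by
  have h1 : AnalyticAt ℝ (fun x : ℝ => c * x) 0 := analyticAt_const.mul analyticAt_id
  have h2 : AnalyticAt ℝ 𝒲 ((fun x : ℝ => c * x) 0) := by simpa using h
  exact analyticAt_const.mul (h2.comp h1)

/-- Smoothness away from the origin is preserved by the scaling (`c ≠ 0`). [folklore] -/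
theorem contDiffAt_scale {𝒲 : ℝ → ℝ} {c : ℝ} {n : WithTop ℕ∞} (hc : c ≠ 0)
    (h : ∀ ζ : ℝ, ζ ≠ 0 → ContDiffAt ℝ n 𝒲 ζ) :
    ∀ ζ : ℝ, ζ ≠ 0 → ContDiffAt ℝ n (fun x => c⁻¹ * 𝒲 (c * x)) ζ := by
  intro ζ hζ
  have h1 : ContDiffAt ℝ n (fun x : ℝ => c * x) ζ := contDiffAt_const.mul contDiffAt_id
  have h2 : ContDiffAt ℝ n 𝒲 ((fun x : ℝ => c * x) ζ) := h _ (mul_ne_zero hc hζ)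
  exact contDiffAt_const.mul (h2.comp ζ h1)

/-- Positivity of the rescaled sound speed is preserved by the scaling with `c > 0`. [folklore] -/
theorem pos_scale {𝒲 : ℝ → ℝ} {c : ℝ} (hc : 0 < c)
    (h : ∀ ζ : ℝ, 0 ≤ ζ → 0 < 𝒲 ζ + 𝒲 (-ζ)) :
    ∀ ζ : ℝ, 0 ≤ ζ → 0 < (fun x => c⁻¹ * 𝒲 (c * x)) ζ + (fun x => c⁻¹ * 𝒲 (c * x)) (-ζ) := by
  intro ζ hζ
  have h1 := h (c * ζ) (mul_nonneg hc.le hζ)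
  simp only [mul_neg]
  rw [← mul_add]
  exact mul_pos (inv_pos.mpr hc) h1

/-- The end point `P_∞` (`𝒲(ζ)/ζ → 0`) is preserved by the scaling with `c > 0`. [folklore] -/
theorem tendsto_div_scale {𝒲 : ℝ → ℝ} {c : ℝ} (hc : 0 < c)
    (h : Tendsto (fun ζ => 𝒲 ζ / ζ) atTop (𝓝 0)) :
    Tendsto (fun ζ => (fun x => c⁻¹ * 𝒲 (c * x)) ζ / ζ) atTop (𝓝 0) := by
  have h1 : Tendsto (fun ζ : ℝ => c * ζ) atTop atTop := tendsto_id.const_mul_atTop hc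
  have h2 := h.comp h1
  refine (h2.congr' ?_ : _)
  filter_upwards [eventually_ne_atTop 0] with ζ hζ
  simp only [Function.comp_apply]
  field_simp

/-- The end point `P_∞` (`𝒲(−ζ)/ζ → 0`) is preserved by the scaling with `c > 0`. [folklore] -/
theorem tendsto_neg_div_scale {𝒲 : ℝ → ℝ} {c : ℝ} (hc : 0 < c)
    (h : Tendsto (fun ζ => 𝒲 (-ζ) / ζ) atTop (𝓝 0)) :
    Tendsto (fun ζ => (fun x => c⁻¹ * 𝒲 (c * x)) (-ζ) / ζ) atTop (𝓝 0) := by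
  have h1 : Tendsto (fun ζ : ℝ => c * ζ) atTop atTop := tendsto_id.const_mul_atTop hc
  have h2 := h.comp h1
  refine (h2.congr' ?_ : _)
  filter_upwards [eventually_ne_atTop 0] with ζ hζ
  simp only [Function.comp_apply, mul_neg]
  field_simp

end BuckmasterCaolaboraGomezserrano2025

end Literature.Analysis.FluidPDE
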